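import Mathlib
import HarnessLib
import Summits.NavierStokesRegularity.NavierStokesRegularity.Theorems.UnthreadedDoorFarFieldFlatDirection
import Summits.NavierStokesRegularity.NavierStokesRegularity.Theorems.UnthreadedDoorAntidynamoWallMildMovingCentre

/-!
# Route `UnthreadedDoor` / `ThreadingFlux`, crux `PoloidalLiouville` (stmt-NavierStokesRegularity-1222), antidynamo v2 skeleton (sha16 `4ebf5683127b`),
# WALL `stub_scalarLiouville`: THE FAR-FIELD / CENTRE RE-CUT, TYPED — vorticity decay at infinity from the flat-direction Liouville problem

Support file (seat leafhand-ns-unthreadeddoor-3 g30, cell decomp-ns), `--supports stmt-NavierStokesRegularity-1222 --as helper`; theorems only,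
no definitions, no named facts.  Companion of `…UnthreadedDoorFarFieldFlatDirection` (p840809: far-field limits of unthreaded flows are FLAT-DIRECTION
bounded ancient Oseen-mild flows).

The recommendation of record of the LAND-ONLY hands on ⟨1222⟩ (g28/g29, 35th/36th concurring) is a planner RE-CUT of the wall = crux along the
geometry «far field / centre», with the shared open core

  **(FDL) BOUNDED FLAT-DIRECTION LIOUVILLE** — a bounded, continuous, Oseen-mild ancient field on `(−∞,0) × ℝ³` with weakly divergence-free slices
  (hence jointly analytic, smooth slices, uniform derivative bounds — all supplied as hypotheses) whose vorticity is everywhere orthogonal to ONE fixed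
  `e ≠ 0` is irrotational.  [cf. crux ⟨19708⟩ `PoloidalWindowRigidity`: the same flat-direction class WITH the Type-I rate; (FDL) contains KNSS 2009
  Thm 5.2 (axisymmetric no swirl about an axis `∥ e`) and the planar case (KNSS Thm 5.1, vorticity `∥` a fixed direction); OPEN in print.]

This file types what (FDL) buys for the wall and what is then left:

* §1 `exists_subseq_direction` — a sequence `x_k → ∞` in `ℝ³` has a subsequence with convergent directions `x_k/‖x_k‖ → e`, `e ≠ 0`.
* §2 ★★ `curl_tendsto_zero_of_flatDirectionLiouville` — **(FDL) ⟹ THE VORTICITY OF AN UNTHREADED FLOW DECAYS AT SPATIAL INFINITY**: for `w` bounded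
  continuous Oseen-mild ancient with weakly divergence-free slices, unthreaded about an arbitrary moving centre `p(t)`, and every `t < 0`:
  `curl w(t)(x_k) → 0` along EVERY sequence `x_k → ∞` (sub-subsequence argument: directions converge along a subsequence, the receding-centre limit
  `W` of p840809 is a flat-direction flow, (FDL) kills its curl, and `curl w(t)(x_{k_j}) → curl W(t)(0) = 0`).
  ★ `curl_tendsto_zero_of_flatDirectionLiouville_of_wall` — the same for the wall's own duality class with a fixed centre (Oseen gauge).
* §3 ★ `stubScalarLiouville_of_flatDirectionLiouville_of_centredEndgame` / `poloidalLiouville_of_…` — **THE RE-CUT CONE, BY NAME**: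
  WALL (hence the crux of both routes) ⟸ (FDL) ∧ **(CE) CENTRED ENDGAME** := «a flow of the mild moving-centre class (ML) of
  `…WallMildMovingCentre` whose vorticity tends to `0` at spatial infinity on every slice is irrotational», via `stubScalarLiouville_of_mild_movingCentre`.

Sizes / status for the planner: (FDL) [XL, open; the Type-I-free form of ⟨19708⟩'s class], (CE) [L–XL, open: a Liouville theorem for bounded
ancient unthreaded flows with QUALITATIVELY decaying vorticity — KNSS's half-ball step (Lemma 2.1, tree `KNSSMaxPrincipleR5`) needs a scalar with a
maximum principle that is `O(1/r)` at infinity, which the zonal gauge `ω_θ/r` supplies and for which no symmetry-free substitute is known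
(Cruxes/PoloidalLiouville/AzimuthalCartanResults.md)].  HONEST LABEL: conditional re-cut certificate + one compactness consequence of (FDL); NO load
is moved (both pieces open), no stub of the skeleton is closed; the wall / crux ⟨1222⟩ stay OPEN; nothing here bears on Navier–Stokes regularity;
no summit statement is proved.
[cite: KochNadirashviliSereginSverak2009, Lemma 6.1, §4, Thms 5.1–5.2 (arXiv:0709.3599 pp. 8–11); LeiRenZhang2019, Lemma 5.1 (arXiv:1902.11229 p. 13)]
-/

noncomputable section

-- the summit and its single sub-problem share the name (CONVENTIONS §1)
set_option linter.dupNamespace false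

open scoped Topology InnerProductSpace RealInnerProductSpace ContDiff
open Filter Set Function Metric MeasureTheory
open Literature.Analysis Literature.Analysis.FluidPDE Literature.Analysis.UnboundedOperators

namespace Summit.NavierStokesRegularity.NavierStokesRegularity.Theorems.PoloidalLiouville.FarField

open Summit.NavierStokesRegularity.NavierStokesRegularity.Theorems.PoloidalLiouville.NetFlux (E3)
open Summit.NavierStokesRegularity.NavierStokesRegularity.Theorems.LocalSineTubeDoorProfileAlignedWindowRigidityAncient
  (analyticOnNhd_uncurry)

/-! ### §1 Directions of a receding sequence -/

/-- A sequence `x_k → ∞` in `ℝ³` has a subsequence whose directions `x_k/‖x_k‖` converge to a unit (in particular non-zero) vector. [folklore] -/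
theorem exists_subseq_direction {x : ℕ → E3} (hx : Tendsto (fun k => ‖x k‖) atTop atTop) :
    ∃ (e : E3) (ms : ℕ → ℕ), e ≠ 0 ∧ StrictMono ms ∧
      Tendsto (fun k => ‖x (ms k)‖⁻¹ • x (ms k)) atTop (𝓝 e) := by
  have hu : ∀ k, ‖x k‖⁻¹ • x k ∈ closedBall (0 : E3) 1 := fun k => by
    rw [mem_closedBall_zero_iff, norm_smul, norm_inv, norm_norm]
    rcases eq_or_ne ‖x k‖ 0 with h | h
    · rw [h]; simp
    · rw [inv_mul_cancel₀ h]
  obtain ⟨e, -, ms, hms, hlim⟩ := (isCompact_closedBall (0 : E3) 1).tendsto_subseq hu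
  refine ⟨e, ms, ?_, hms, hlim⟩
  -- `‖e‖ = 1`: the directions are eventually unit vectors
  have hpos : ∀ᶠ k in atTop, 0 < ‖x (ms k)‖ :=
    ((hx.comp hms.tendsto_atTop).eventually (eventually_gt_atTop 0))
  have hnorm : Tendsto (fun k => ‖‖x (ms k)‖⁻¹ • x (ms k)‖) atTop (𝓝 ‖e‖) := hlim.norm
  have hone : (fun k => ‖‖x (ms k)‖⁻¹ • x (ms k)‖) =ᶠ[atTop] fun _ => (1 : ℝ) := by
    filter_upwards [hpos] with k hk
    rw [norm_smul, norm_inv, norm_norm, inv_mul_cancel₀ hk.ne']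
  have he1 : ‖e‖ = 1 := tendsto_nhds_unique_of_eventuallyEq hnorm tendsto_const_nhds hone
  intro he0
  rw [he0, norm_zero] at he1
  exact zero_ne_one he1

/-! ### §2 (FDL) ⟹ the vorticity of an unthreaded flow decays at spatial infinity -/

/-- ★★ **(FDL) ⟹ VORTICITY DECAY AT INFINITY FOR UNTHREADED FLOWS.**  Assume the bounded flat-direction Liouville statement (FDL) of the module
docstring.  Let `w` be bounded, continuous and Oseen-mild on `(−∞,0) × ℝ³` with weakly divergence-free slices, its vorticity tangent at each `t < 0`
to the spheres about an arbitrary moving centre `p t`.  Then for every `t < 0` and every sequence `x_k` with `‖x_k‖ → ∞`: `curl w(t)(x_k) → 0`.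
[cite: KochNadirashviliSereginSverak2009, Lemma 6.1 (arXiv:0709.3599 p. 11); LeiRenZhang2019, Lemma 5.1 (arXiv:1902.11229 p. 13)] -/
theorem curl_tendsto_zero_of_flatDirectionLiouville
    (hFDL : ∀ (W : ℝ → E3 → E3) (e : E3), e ≠ 0 →
      ContinuousOn (uncurry W) (Iio (0 : ℝ) ×ˢ univ) →
      (∃ B : ℝ, ∀ t < 0, ∀ x, ‖W t x‖ ≤ B) →
      (∀ t < 0, IsWeaklyDivFree (W t)) →
      (∀ s t : ℝ, s < t → t < 0 → ∀ x,
        W t x = heatExtension (W s) (t - s) x - oseenDuhamel 1 s W W t x) →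
      AnalyticOnNhd ℝ (uncurry W) (Iio (0 : ℝ) ×ˢ (univ : Set E3)) →
      (∀ t < 0, ContDiff ℝ ∞ (W t)) →
      (∀ k : ℕ, ∃ K : ℝ, ∀ t < 0, ∀ x, ‖iteratedFDeriv ℝ k (W t) x‖ ≤ K) →
      (∀ t < 0, ∀ x, ⟪e, curl (W t) x⟫ = 0) →
      ∀ t < 0, ∀ x, curl (W t) x = 0)
    {w : ℝ → E3 → E3} {B : ℝ} (p : ℝ → E3)
    (hwc : ContinuousOn (uncurry w) (Iio (0 : ℝ) ×ˢ univ))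
    (hwdiv : ∀ t < 0, IsWeaklyDivFree (w t))
    (hwmild : ∀ s t : ℝ, s < t → t < 0 → ∀ x,
      w t x = heatExtension (w s) (t - s) x - oseenDuhamel 1 s w w t x)
    (hwB : ∀ t < 0, ∀ x, ‖w t x‖ ≤ B)
    (hun : ∀ t < 0, ∀ x, ⟪x - p t, curl (w t) x⟫ = 0) :
    ∀ t < 0, ∀ x : ℕ → E3, Tendsto (fun k => ‖x k‖) atTop atTop →
      Tendsto (fun k => curl (w t) (x k)) atTop (𝓝 0) := by
  intro t ht x hx
  refine tendsto_of_subseq_tendsto fun ns hns => ?_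
  -- along the subsequence `ns` choose a further subsequence with convergent directions
  have hx' : Tendsto (fun k => ‖x (ns k)‖) atTop atTop := hx.comp hns
  obtain ⟨e, ms₁, he0, hms₁, hdir⟩ := exists_subseq_direction hx'
  have hy : Tendsto (fun k => ‖x (ns (ms₁ k))‖) atTop atTop := hx'.comp hms₁.tendsto_atTop
  -- receding-centre compactness: a flat-direction far-field limit `W`
  obtain ⟨φ, W, hφ, hWc, hWdiv, hWB, hWmild, hWsm, hWK, -, hcurl, hflat⟩ :=
    exists_farField_limit_flatDirection p hwc hwdiv hwmild hwB hun (y := fun k => x (ns (ms₁ k))) hy hdir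
  have hWA : AnalyticOnNhd ℝ (uncurry W) (Iio (0 : ℝ) ×ˢ (univ : Set E3)) :=
    analyticOnNhd_uncurry hWc (fun δ _ => ⟨B, fun s hs z => hWB s (by linarith) z⟩) hWmild
  -- (FDL) kills the curl of the limit
  have h0 : curl (W t) 0 = 0 := hFDL W e he0 hWc ⟨B, hWB⟩ hWdiv hWmild hWA hWsm hWK hflat t ht 0
  refine ⟨fun n => ms₁ (φ n), ?_⟩
  have h := hcurl t ht 0
  simp_rw [zero_add, h0] at h
  exact h

/-- ★ **(FDL) ⟹ VORTICITY DECAY AT INFINITY FOR THE WALL'S CLASS** (bounded ancient mild in the duality sense, measurable slices, jointly smooth,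
vorticity tangent to the spheres about a FIXED `x₀`), through the Oseen gauge `v(t) = w(t, · − A(t)) + c(t)`.
[cite: KochNadirashviliSereginSverak2009, §4 (i)–(ii), Lemma 6.1 (arXiv:0709.3599 pp. 8, 11)] -/
theorem curl_tendsto_zero_of_flatDirectionLiouville_of_wall
    (hFDL : ∀ (W : ℝ → E3 → E3) (e : E3), e ≠ 0 →
      ContinuousOn (uncurry W) (Iio (0 : ℝ) ×ˢ univ) →
      (∃ B : ℝ, ∀ t < 0, ∀ x, ‖W t x‖ ≤ B) →
      (∀ t < 0, IsWeaklyDivFree (W t)) →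
      (∀ s t : ℝ, s < t → t < 0 → ∀ x,
        W t x = heatExtension (W s) (t - s) x - oseenDuhamel 1 s W W t x) →
      AnalyticOnNhd ℝ (uncurry W) (Iio (0 : ℝ) ×ˢ (univ : Set E3)) →
      (∀ t < 0, ContDiff ℝ ∞ (W t)) →
      (∀ k : ℕ, ∃ K : ℝ, ∀ t < 0, ∀ x, ‖iteratedFDeriv ℝ k (W t) x‖ ≤ K) →
      (∀ t < 0, ∀ x, ⟪e, curl (W t) x⟫ = 0) →
      ∀ t < 0, ∀ x, curl (W t) x = 0)
    (v : ℝ → E3 → E3) (x₀ : E3)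
    (hB : IsBoundedAncientMildSolution 1 v)
    (hm : ∀ t < 0, AEStronglyMeasurable (v t) volume)
    (hsm : ContDiffOn ℝ (⊤ : ℕ∞) (uncurry v) (Iio 0 ×ˢ univ))
    (hun : ∀ t < 0, ∀ x, ⟪x - x₀, curl (v t) x⟫ = 0) :
    ∀ t < 0, ∀ x : ℕ → E3, Tendsto (fun k => ‖x k‖) atTop atTop →
      Tendsto (fun k => curl (v t) (x k)) atTop (𝓝 0) := by
  -- ## the Oseen gauge, everywhere
  obtain ⟨w, A, c, -, hwc, ⟨K, hK⟩, hwdiv, hwmild, -, hrep⟩ := Theorems.oseen_gauge_of_aestronglyMeasurable v hB hm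
  have hrep' : ∀ s < 0, ∀ z, v s z = w s (z - A s) + c s :=
    fun s hs z => CellFlux.galilean_rep_everywhere hsm.continuousOn hwc hrep hs z
  have hws : ∀ s < 0, w s = fun z => v s (z + A s) - c s := fun s hs => by
    funext z
    have h := hrep' s hs (z + A s)
    rw [add_sub_cancel_right] at h
    rw [h, add_sub_cancel_right]
  have hw_curl : ∀ s < 0, ∀ z, curl (w s) z = curl (v s) (z + A s) := fun s hs z => by
    rw [hws s hs, CellFlux.curl_comp_add_sub_const]
  have htan : ∀ t < 0, ∀ z, ⟪z - (x₀ - A t), curl (w t) z⟫ = 0 := fun t ht z => by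
    rw [hw_curl t ht]
    have h := hun t ht (z + A t)
    have e1 : z + A t - x₀ = z - (x₀ - A t) := by abel
    rwa [e1] at h
  -- ## decay for the representative along `x k − A t`, then back to `v`
  intro t ht x hx
  have hx' : Tendsto (fun k => ‖x k - A t‖) atTop atTop := by
    refine tendsto_atTop_mono (fun k => norm_sub_norm_le (x k) (A t)) ?_
    exact tendsto_atTop_add_const_right _ _ hx
  have h := curl_tendsto_zero_of_flatDirectionLiouville hFDL (fun s => x₀ - A s) hwc hwdiv hwmild hK htan t ht
    (fun k => x k - A t) hx'
  have hrw : ∀ k, curl (w t) (x k - A t) = curl (v t) (x k) := fun k => by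
    rw [hw_curl t ht, sub_add_cancel]
  simp_rw [hrw] at h
  exact h

/-! ### §3 The re-cut cone: WALL ⟸ (FDL) ∧ (CE), by name -/

/-- ★ **THE FAR-FIELD / CENTRE RE-CUT OF THE WALL, BY NAME.**  The wall `StubScalarLiouville` follows from (FDL) (bounded flat-direction Liouville)
together with the CENTRED ENDGAME (CE): «a flow of the mild moving-centre class (ML) of `…WallMildMovingCentre` — bounded continuous Oseen-mild
ancient, weakly divergence-free slices, jointly analytic, smooth slices, vorticity tangent to the spheres about a continuous path `p` — whose vorticity
tends to `0` at spatial infinity on every slice is irrotational».  Both hypotheses are OPEN; (FDL) discharges exactly the far field.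
[cite: KochNadirashviliSereginSverak2009, §4, Lemma 6.1, Thm 5.2 (arXiv:0709.3599 pp. 8–11)] -/
theorem stubScalarLiouville_of_flatDirectionLiouville_of_centredEndgame
    (hFDL : ∀ (W : ℝ → E3 → E3) (e : E3), e ≠ 0 →
      ContinuousOn (uncurry W) (Iio (0 : ℝ) ×ˢ univ) →
      (∃ B : ℝ, ∀ t < 0, ∀ x, ‖W t x‖ ≤ B) →
      (∀ t < 0, IsWeaklyDivFree (W t)) →
      (∀ s t : ℝ, s < t → t < 0 → ∀ x,
        W t x = heatExtension (W s) (t - s) x - oseenDuhamel 1 s W W t x) →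
      AnalyticOnNhd ℝ (uncurry W) (Iio (0 : ℝ) ×ˢ (univ : Set E3)) →
      (∀ t < 0, ContDiff ℝ ∞ (W t)) →
      (∀ k : ℕ, ∃ K : ℝ, ∀ t < 0, ∀ x, ‖iteratedFDeriv ℝ k (W t) x‖ ≤ K) →
      (∀ t < 0, ∀ x, ⟪e, curl (W t) x⟫ = 0) →
      ∀ t < 0, ∀ x, curl (W t) x = 0)
    (hCE : ∀ (w : ℝ → E3 → E3) (p : ℝ → E3),
      ContinuousOn (uncurry w) (Iio (0 : ℝ) ×ˢ univ) →
      (∃ K : ℝ, ∀ t < 0, ∀ y, ‖w t y‖ ≤ K) →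
      (∀ t < 0, IsWeaklyDivFree (w t)) →
      (∀ s t : ℝ, s < t → t < 0 → ∀ y,
        w t y = heatExtension (w s) (t - s) y - oseenDuhamel 1 s w w t y) →
      AnalyticOnNhd ℝ (uncurry w) (Iio (0 : ℝ) ×ˢ (univ : Set E3)) →
      (∀ t < 0, ContDiff ℝ (⊤ : ℕ∞) (w t)) →
      Continuous p →
      (∀ t < 0, ∀ y, ⟪y - p t, curl (w t) y⟫ = 0) →
      (∀ t < 0, ∀ x : ℕ → E3, Tendsto (fun k => ‖x k‖) atTop atTop →
        Tendsto (fun k => curl (w t) (x k)) atTop (𝓝 0)) →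
      ∀ t < 0, ∀ y, curl (w t) y = 0) :
    Antidynamo.StubScalarLiouville :=
  Antidynamo.OneInstant.stubScalarLiouville_of_mild_movingCentre
    fun w p hwc hK hwdiv hwmild hwA hwsm hp htan => by
      obtain ⟨K, hK'⟩ := hK
      exact hCE w p hwc ⟨K, hK'⟩ hwdiv hwmild hwA hwsm hp htan
        (curl_tendsto_zero_of_flatDirectionLiouville hFDL p hwc hwdiv hwmild hK' htan)

/-- ★ **… AND THE CRUX** (route `UnthreadedDoor` decl) from (FDL) ∧ (CE), by name (composition p793469). -/
theorem poloidalLiouville_of_flatDirectionLiouville_of_centredEndgame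
    (hFDL : ∀ (W : ℝ → E3 → E3) (e : E3), e ≠ 0 →
      ContinuousOn (uncurry W) (Iio (0 : ℝ) ×ˢ univ) →
      (∃ B : ℝ, ∀ t < 0, ∀ x, ‖W t x‖ ≤ B) →
      (∀ t < 0, IsWeaklyDivFree (W t)) →
      (∀ s t : ℝ, s < t → t < 0 → ∀ x,
        W t x = heatExtension (W s) (t - s) x - oseenDuhamel 1 s W W t x) →
      AnalyticOnNhd ℝ (uncurry W) (Iio (0 : ℝ) ×ˢ (univ : Set E3)) →
      (∀ t < 0, ContDiff ℝ ∞ (W t)) →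
      (∀ k : ℕ, ∃ K : ℝ, ∀ t < 0, ∀ x, ‖iteratedFDeriv ℝ k (W t) x‖ ≤ K) →
      (∀ t < 0, ∀ x, ⟪e, curl (W t) x⟫ = 0) →
      ∀ t < 0, ∀ x, curl (W t) x = 0)
    (hCE : ∀ (w : ℝ → E3 → E3) (p : ℝ → E3),
      ContinuousOn (uncurry w) (Iio (0 : ℝ) ×ˢ univ) →
      (∃ K : ℝ, ∀ t < 0, ∀ y, ‖w t y‖ ≤ K) →
      (∀ t < 0, IsWeaklyDivFree (w t)) →
      (∀ s t : ℝ, s < t → t < 0 → ∀ y,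
        w t y = heatExtension (w s) (t - s) y - oseenDuhamel 1 s w w t y) →
      AnalyticOnNhd ℝ (uncurry w) (Iio (0 : ℝ) ×ˢ (univ : Set E3)) →
      (∀ t < 0, ContDiff ℝ (⊤ : ℕ∞) (w t)) →
      Continuous p →
      (∀ t < 0, ∀ y, ⟪y - p t, curl (w t) y⟫ = 0) →
      (∀ t < 0, ∀ x : ℕ → E3, Tendsto (fun k => ‖x k‖) atTop atTop →
        Tendsto (fun k => curl (w t) (x k)) atTop (𝓝 0)) →
      ∀ t < 0, ∀ y, curl (w t) y = 0) :
    Summit.NavierStokesRegularity.NavierStokesRegularity.Theses.UnthreadedDoor.PoloidalLiouville :=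
  Antidynamo.poloidalLiouville_of_stubScalarLiouville'
    (stubScalarLiouville_of_flatDirectionLiouville_of_centredEndgame hFDL hCE)

end Summit.NavierStokesRegularity.NavierStokesRegularity.Theorems.PoloidalLiouville.FarField

end
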